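import Mathlib
import HarnessLib
import Summits.Ventures.LatticeQCDFlow.Exactness.SphereTangentialLaplacian
import Summits.Ventures.LatticeQCDFlow.Exactness.SphereLOFlowAction

/-!
# Calculus of Engel–Schaefer's site operator `∂̃ⁱ_n∂̃ⁱ_n`: linearity, and its values on functions that are constant, affine or quadratic in one site variable (degree-2 spherical harmonics: eigenvalue `2d`)

HONEST FRAMING: exact (Metropolis-corrected) sampling algorithms for lattice gauge theory;
figures of merit are autocorrelation/cost numbers at stated couplings and volumes; no
continuum-physics claim.

Venture `LatticeQCDFlow` (cell pub-lqcd), topic `Exactness`; FANOUT row 7 (`s0-cpn-null`: the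
S0-D1 rung — 2D CP⁹, Lüscher's LO trivializing map inside HMC, Engel–Schaefer 2011).  NEW WORK of
the cell over Mathlib (the Laplacian `Δ`, `NormedSpace.normalize`) and the tree's
`SphereTangentialLaplacian.lean` (`laplacian_comp_normalize`, `laplacian_inner_comp_normalize`)
and `SphereLOFlowAction.lean` (`siteLaplacian`); nothing is cited as a fact.  Printed counterparts,
NAMED ONLY: Engel–Schaefer, Comput. Phys. Commun. 182 (2011) 2107, §2.2 eq. (12), §3 (the operator
`−Σ_n ∂̃ⁱ_n∂̃ⁱ_n` of Lüscher's equations); M. Lüscher, Commun. Math. Phys. 293 (2010) 899, §4.3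
eqs. (4.12)–(4.15) (the order-by-order equations whose right-hand sides are polynomial in the
site variables — here: what `∂̃·∂̃` does to such polynomials, degree ≤ 2).

## Content (`E` finite-dimensional, `d = dim E`, `‖x n‖ = 1`)

* §1 `hasFDerivAt_inner_mul_inner`, `fderiv_fderiv_inner_mul_inner`, `laplacian_inner_mul_inner`
  (`Δ(⟪a,·⟫⟪b,·⟫) = 2⟪a, b⟫`), **`laplacian_inner_mul_inner_comp_normalize`** — the degree-2 case
  of E–S's operator: `Δ((⟪a,·⟫⟪b,·⟫) ∘ ν)(x) = 2⟪a, b⟫ − 2d ⟪a, x⟫⟪b, x⟫`; equivalently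
  `⟪a,x⟫⟪b,x⟫ − ⟪a,b⟫/d` is an eigenfunction of `−∂̃·∂̃` with eigenvalue `2d` (degree-2 spherical
  harmonics; CP(N−1): `4N`).
* §2 THE SITE OPERATOR ON FUNCTIONS OF KNOWN SHAPE IN ONE SITE VARIABLE: `siteLaplacian_eq_of_forall`
  (only the section `y ↦ G(x_n ← y)` matters), **`siteLaplacian_of_const`** (`0`),
  **`siteLaplacian_of_affine`** (`−(d−1)⟪w, x_n⟫` for `G(x_n ← y) = ⟪w, y⟫ + c`),
  **`siteLaplacian_of_quadratic`** (`2⟪a,b⟫ − 2d⟪a,x_n⟫⟪b,x_n⟫` for `G(x_n ← y) = ⟪a,y⟫⟪b,y⟫`).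
* §3 LINEARITY: `siteLaplacian_add`, `siteLaplacian_sub`, `siteLaplacian_const_mul`,
  `siteLaplacian_finset_sum` (for summands of class `C²` in the site variable).

These are the building blocks for the next order of Lüscher's expansion for the CP(N−1)/O(N)
action (`SphereNLOFlowAction.lean`): every term of `Σ_n ‖p_n‖²` is constant, affine or a product
of two affine functions in each single site variable.

NOT CLAIMED: higher spherical harmonics; anything about the flow; anything quantitative.
-/

noncomputable section

namespace Summit.Ventures.LatticeQCDFlow.Exactness

open NormedSpace Filter Laplacian InnerProductSpace
open scoped RealInnerProductSpace Topology

variable {E : Type*} [NormedAddCommGroup E] [InnerProductSpace ℝ E]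

/-! ## §1 Products of two linear functions under `Δ` and under `∂̃·∂̃` -/

section Quadratic

/-- The derivative of `y ↦ ⟪a, y⟫⟪b, y⟫`. -/
theorem hasFDerivAt_inner_mul_inner (a b y : E) :
    HasFDerivAt (fun z : E => ⟪a, z⟫ * ⟪b, z⟫) (⟪a, y⟫ • innerSL ℝ b + ⟪b, y⟫ • innerSL ℝ a) y := by
  have h := (innerSL ℝ a).hasFDerivAt.mul (innerSL ℝ b).hasFDerivAt (x := y)
  simp only [innerSL_apply_apply] at h
  exact h

/-- `fderiv` of `y ↦ ⟪a, y⟫⟪b, y⟫`, as a function. -/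
theorem fderiv_inner_mul_inner (a b : E) :
    fderiv ℝ (fun z : E => ⟪a, z⟫ * ⟪b, z⟫) = fun y => ⟪a, y⟫ • innerSL ℝ b + ⟪b, y⟫ • innerSL ℝ a :=
  funext fun y => (hasFDerivAt_inner_mul_inner a b y).fderiv

/-- The second derivative of `y ↦ ⟪a, y⟫⟪b, y⟫` is the constant symmetrised form
`(u, w) ↦ ⟪a, u⟫⟪b, w⟫ + ⟪b, u⟫⟪a, w⟫`. -/
theorem fderiv_fderiv_inner_mul_inner (a b y u w : E) :
    fderiv ℝ (fderiv ℝ (fun z : E => ⟪a, z⟫ * ⟪b, z⟫)) y u w = ⟪a, u⟫ * ⟪b, w⟫ + ⟪b, u⟫ * ⟪a, w⟫ := by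
  rw [fderiv_inner_mul_inner]
  have h1 : HasFDerivAt (fun z : E => ⟪a, z⟫ • innerSL ℝ b) ((innerSL ℝ a).smulRight (innerSL ℝ b)) y := by
    have h := (innerSL ℝ a).hasFDerivAt.smul_const (innerSL ℝ b) (x := y)
    simp only [innerSL_apply_apply] at h
    exact h
  have h2 : HasFDerivAt (fun z : E => ⟪b, z⟫ • innerSL ℝ a) ((innerSL ℝ b).smulRight (innerSL ℝ a)) y := by
    have h := (innerSL ℝ b).hasFDerivAt.smul_const (innerSL ℝ a) (x := y)
    simp only [innerSL_apply_apply] at h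
    exact h
  have h12 : HasFDerivAt (fun z : E => ⟪a, z⟫ • innerSL ℝ b + ⟪b, z⟫ • innerSL ℝ a)
      ((innerSL ℝ a).smulRight (innerSL ℝ b) + (innerSL ℝ b).smulRight (innerSL ℝ a)) y :=
    h1.add h2
  rw [h12.fderiv]
  simp only [add_apply, ContinuousLinearMap.smulRight_apply, innerSL_apply_apply, smul_apply,
    smul_eq_mul]

/-- `y ↦ ⟪a, y⟫⟪b, y⟫` is smooth. -/
theorem contDiff_inner_mul_inner (a b : E) {n : WithTop ℕ∞} :
    ContDiff ℝ n (fun z : E => ⟪a, z⟫ * ⟪b, z⟫) := by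
  have h : (fun z : E => ⟪a, z⟫ * ⟪b, z⟫) = fun z => innerSL ℝ a z * innerSL ℝ b z := by
    funext z; simp only [innerSL_apply_apply]
  rw [h]
  exact (innerSL ℝ a).contDiff.mul (innerSL ℝ b).contDiff

variable [FiniteDimensional ℝ E]

/-- **The flat Laplacian of a product of two linear functions**: `Δ(⟪a,·⟫⟪b,·⟫) = 2⟪a, b⟫`. -/
theorem laplacian_inner_mul_inner (a b x : E) :
    Δ (fun z : E => ⟪a, z⟫ * ⟪b, z⟫) x = 2 * ⟪a, b⟫ := by
  rw [laplacian_eq_iteratedFDeriv_orthonormalBasis _ (stdOrthonormalBasis ℝ E)]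
  simp only [iteratedFDeriv_two_apply, Matrix.cons_val_zero, Matrix.cons_val_one,
    fderiv_fderiv_inner_mul_inner]
  have h : ∀ i, ⟪a, stdOrthonormalBasis ℝ E i⟫ * ⟪b, stdOrthonormalBasis ℝ E i⟫ +
      ⟪b, stdOrthonormalBasis ℝ E i⟫ * ⟪a, stdOrthonormalBasis ℝ E i⟫ =
      2 * (⟪a, stdOrthonormalBasis ℝ E i⟫ * ⟪stdOrthonormalBasis ℝ E i, b⟫) := fun i => by
    rw [real_inner_comm (stdOrthonormalBasis ℝ E i) b]; ring
  simp only [h]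
  rw [← Finset.mul_sum, (stdOrthonormalBasis ℝ E).sum_inner_mul_inner]

/-- **The degree-2 case of E–S's operator.**  For `‖x‖ = 1`,
`Δ((⟪a,·⟫⟪b,·⟫) ∘ ν)(x) = 2⟪a, b⟫ − 2d ⟪a, x⟫⟪b, x⟫` (`d = dim E`): the traceless part
`⟪a,x⟫⟪b,x⟫ − ⟪a,b⟫/d` of a quadratic function restricted to the unit sphere is an eigenfunction of
`−∂̃·∂̃` with eigenvalue `2d`. -/
theorem laplacian_inner_mul_inner_comp_normalize {x : E} (hx : ‖x‖ = 1) (a b : E) :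
    Δ (fun z : E => ⟪a, normalize z⟫ * ⟪b, normalize z⟫) x =
      2 * ⟪a, b⟫ - 2 * (Module.finrank ℝ E : ℝ) * (⟪a, x⟫ * ⟪b, x⟫) := by
  have h := laplacian_comp_normalize (f := fun z : E => ⟪a, z⟫ * ⟪b, z⟫) hx
    (contDiff_inner_mul_inner a b).contDiffAt
  rw [h, laplacian_inner_mul_inner, fderiv_fderiv_inner_mul_inner,
    (hasFDerivAt_inner_mul_inner a b x).fderiv]
  simp only [add_apply, smul_apply, innerSL_apply_apply, smul_eq_mul]
  ring

end Quadratic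

/-! ## §2 The site operator on functions of known shape in one site variable -/

section Site

variable {Λ : Type*} [DecidableEq Λ]

/-- A function of class `C²` in the site variable gives a `C²` section along `ν` at `x_n ≠ 0`. -/
theorem contDiffAt_section_comp_normalize {G : (Λ → E) → ℝ} {x : Λ → E} {n : Λ} (hx : x n ≠ 0)
    (hG : ContDiff ℝ 2 (fun y => G (Function.update x n y))) :
    ContDiffAt ℝ 2 (fun y : E => G (Function.update x n (normalize y))) (x n) :=
  (hG.contDiffAt (x := normalize (x n))).comp (x n) (contDiffAt_normalize hx)

variable [FiniteDimensional ℝ E]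

/-- **Only the section matters**: if `G(x_n ← y) = φ(y)` for all `y`, then
`∂̃_n·∂̃_n G (x) = Δ(φ ∘ ν)(x_n)`. -/
theorem siteLaplacian_eq_of_forall {G : (Λ → E) → ℝ} {x : Λ → E} {n : Λ} {φ : E → ℝ}
    (h : ∀ y, G (Function.update x n y) = φ y) :
    siteLaplacian n G x = Δ (fun z : E => φ (normalize z)) (x n) := by
  unfold siteLaplacian
  have hfun : (fun y : E => G (Function.update x n (normalize y))) = fun z => φ (normalize z) :=
    funext fun y => h _
  rw [hfun]

/-- **Constant in the site variable ⇒ `0`.** -/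
theorem siteLaplacian_of_const {G : (Λ → E) → ℝ} {x : Λ → E} {n : Λ} {c : ℝ}
    (h : ∀ y, G (Function.update x n y) = c) : siteLaplacian n G x = 0 := by
  rw [siteLaplacian_eq_of_forall h]
  simp

/-- **Affine in the site variable ⇒ eigenvalue `d − 1`**: if `G(x_n ← y) = ⟪w, y⟫ + c` then
`∂̃_n·∂̃_n G (x) = −(d−1) ⟪w, x_n⟫` (`‖x_n‖ = 1`). -/
theorem siteLaplacian_of_affine {G : (Λ → E) → ℝ} {x : Λ → E} {n : Λ} (hx : ‖x n‖ = 1) {w : E}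
    {c : ℝ} (h : ∀ y, G (Function.update x n y) = ⟪w, y⟫ + c) :
    siteLaplacian n G x = -(((Module.finrank ℝ E : ℝ) - 1) * ⟪w, x n⟫) := by
  rw [siteLaplacian_eq_of_forall h]
  exact laplacian_inner_comp_normalize hx w c

/-- **Product of two linear functions in the site variable ⇒ `2⟪a,b⟫ − 2d⟪a,x_n⟫⟪b,x_n⟫`**: if
`G(x_n ← y) = ⟪a, y⟫⟪b, y⟫` then `∂̃_n·∂̃_n G (x) = 2⟪a, b⟫ − 2d ⟪a, x_n⟫⟪b, x_n⟫`. -/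
theorem siteLaplacian_of_quadratic {G : (Λ → E) → ℝ} {x : Λ → E} {n : Λ} (hx : ‖x n‖ = 1)
    {a b : E} (h : ∀ y, G (Function.update x n y) = ⟪a, y⟫ * ⟪b, y⟫) :
    siteLaplacian n G x =
      2 * ⟪a, b⟫ - 2 * (Module.finrank ℝ E : ℝ) * (⟪a, x n⟫ * ⟪b, x n⟫) := by
  rw [siteLaplacian_eq_of_forall h]
  exact laplacian_inner_mul_inner_comp_normalize hx a b

/-! ## §3 Linearity of the site operator (summands of class `C²` in the site variable) -/

/-- **Additivity**: `∂̃_n·∂̃_n (G + H) = ∂̃_n·∂̃_n G + ∂̃_n·∂̃_n H` for summands of class `C²` in the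
site variable (`x_n ≠ 0`). -/
theorem siteLaplacian_add {G H : (Λ → E) → ℝ} {x : Λ → E} {n : Λ} (hx : x n ≠ 0)
    (hG : ContDiff ℝ 2 (fun y => G (Function.update x n y)))
    (hH : ContDiff ℝ 2 (fun y => H (Function.update x n y))) :
    siteLaplacian n (fun x' => G x' + H x') x = siteLaplacian n G x + siteLaplacian n H x := by
  unfold siteLaplacian
  have h := (contDiffAt_section_comp_normalize hx hG).laplacian_add
    (contDiffAt_section_comp_normalize hx hH)
  exact h

/-- **Scalars**: `∂̃_n·∂̃_n (c G) = c ∂̃_n·∂̃_n G`. -/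
theorem siteLaplacian_const_mul {G : (Λ → E) → ℝ} {x : Λ → E} {n : Λ} (hx : x n ≠ 0)
    (hG : ContDiff ℝ 2 (fun y => G (Function.update x n y))) (c : ℝ) :
    siteLaplacian n (fun x' => c * G x') x = c * siteLaplacian n G x := by
  unfold siteLaplacian
  have h := laplacian_smul c (contDiffAt_section_comp_normalize hx hG)
  simp only [smul_eq_mul] at h
  exact h

/-- **Differences.** -/
theorem siteLaplacian_sub {G H : (Λ → E) → ℝ} {x : Λ → E} {n : Λ} (hx : x n ≠ 0)
    (hG : ContDiff ℝ 2 (fun y => G (Function.update x n y)))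
    (hH : ContDiff ℝ 2 (fun y => H (Function.update x n y))) :
    siteLaplacian n (fun x' => G x' - H x') x = siteLaplacian n G x - siteLaplacian n H x := by
  have hH' : ContDiff ℝ 2 (fun y => (-1 : ℝ) * H (Function.update x n y)) :=
    contDiff_const.mul hH
  have h1 := siteLaplacian_add (G := G) (H := fun x' => (-1 : ℝ) * H x') hx hG hH'
  have h2 := siteLaplacian_const_mul hx hH (-1)
  have hfun : (fun x' => G x' - H x') = fun x' => G x' + (-1 : ℝ) * H x' := by
    funext x'; ring
  rw [hfun, h1, h2]
  ring

/-- **Finite sums**: `∂̃_n·∂̃_n (Σ_i G_i) = Σ_i ∂̃_n·∂̃_n G_i`. -/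
theorem siteLaplacian_finset_sum {ι : Type*} (s : Finset ι) {G : ι → (Λ → E) → ℝ} {x : Λ → E}
    {n : Λ} (hx : x n ≠ 0) (hG : ∀ i ∈ s, ContDiff ℝ 2 (fun y => G i (Function.update x n y))) :
    siteLaplacian n (fun x' => ∑ i ∈ s, G i x') x = ∑ i ∈ s, siteLaplacian n (G i) x := by
  classical
  induction s using Finset.induction_on with
  | empty =>
    simp only [Finset.sum_empty]
    exact siteLaplacian_of_const (c := 0) fun _ => rfl
  | @insert i s hi ih =>
    rw [Finset.sum_insert hi]
    have hG' : ∀ j ∈ s, ContDiff ℝ 2 (fun y => G j (Function.update x n y)) :=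
      fun j hj => hG j (Finset.mem_insert_of_mem hj)
    have hsum : ContDiff ℝ 2 (fun y => ∑ j ∈ s, G j (Function.update x n y)) :=
      ContDiff.sum fun j hj => hG' j hj
    have hfun : (fun x' => ∑ j ∈ insert i s, G j x') = fun x' => G i x' + ∑ j ∈ s, G j x' := by
      funext x'; rw [Finset.sum_insert hi]
    rw [hfun, siteLaplacian_add (G := G i) (H := fun x' => ∑ j ∈ s, G j x') hx
      (hG i (Finset.mem_insert_self i s)) hsum, ih hG']

end Site

end Summit.Ventures.LatticeQCDFlow.Exactness

end
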